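import Summits.QuantumFields.YangMills.Theorems.BalabanUVNodesN11Sect3SupplyChainBorelBObligations
import Summits.QuantumFields.YangMills.Theorems.BalabanUVNodesN11SameWitnessZhPinOfSolvable

/-!
# DAG node N11 — BOREL 𝐁-TERMS ALONG THE WITNESS CHAIN, IV: N11's `SupplierBorel` road RE-KEYED on dag-n11-d's ZhPin same-witness face — 12a″'s `RegOn` and def-R's
# `BgProvisoΛ` DISAPPEAR from the displayed rows of `NoExpansionObligation` ∕ THEOREM 1 along the chain, replaced by K0's per-cube [15]-solvability + cube cover + numerics
# (levels `1…K`), the windows, `PartCompat₁₃`, `0 < M₁ ≤ M`, `2 ≤ cR`; with the LEVEL-0 SUPPLEMENT (no background proviso at all at `k = 0`)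

HEADER — WORK-UNIT METADATA.  Cell `pub-ymgap`, YM-PLAN Track A (D-0062 ∕ D-0149 width seats), seat `pub-ymgap-dag-n11-w1` (g2; WIDTH SEAT 1 of 4 on NODE n11 [B14]),
route `BalabanUVNodes` rev 25, item K1⁷ `StabilityBAtRecordR13SepCoPH` = stmt-QuantumFields-20542 (helper, `--kind proof --supports 20542 --as helper`, count-neutral).
[III] = [Balaban1988Convergent], [15] = [Balaban1985Variational], [B7] = [Balaban1985Averaging], [6] = [Balaban1985RegularSpaces].  g0's FIRST ITEM FOR A SUCCESSOR, executed over
dag-n11-d g13's `…N11SameWitnessZhPinOfSolvable` (★★★★★ `clause_succ_sameWitness_of_hasSect2FormAtZS_of_borelB_of_zhPin_of_solvable`, the consumer-facing endpoint addressed to this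
seat), `…N11SpaceTruncationSameWitnessFibre` (FILE 9, (γ′) on the fibres), `…N11NoExpansionTStepZhPinOfSolvable` (`regOn_cutSel_of_zhPin_of_solvable`), this seat's g0
`…N11Sect3SupplyChainBorelBObligations` (`borelB_chainWitness_pos_of_supplierBorel`) ∕ `…GaussianCertificateRows` (the class rows), dag-n11-e's `…N11Sect3SupplyChainObligationsDefs`
(`NoExpansionObligation`, `SupplyChainAt`, `sLaw₁₃CoPH_all_of_obligations`, `thmP245Laws_of_obligations`), dag-n11-w4's `afibre_rows_adm_of_coercive`.  Sequel (named certificate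
`gaussPinH θ`, `B16.Thm1Printed`): `…N11Sect3SupplyChainBorelBThm1PrintedOfSolvable`.

WHY THIS FILE.  On the `SupplierBorel` road (g0 p600972 ∕ p603200) N11's printed output displayed, besides K0's key, the supplier and the window, two READING-LINE PRIMITIVES per
level: 12a″'s `RegOn` (parents + children) and def-R's `BgProvisoΛ` over the charged reading supports (levels `k`, `k+1`).  dag-n11-d g13 turned both into THEOREMS in the ZhPin
class from K0's per-cube [15]-solvability + cube cover + numerics and the record row `Provisos₁₃SepCoPH.bg` — at levels `1 ≤ k`.  The chain's `NoExpansionObligation` quantifies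
ALL `k < K`; this file supplies the missing level `k = 0` (§1: def-R's `BgProvisoΛ … 0 …` quantifies `1 ≤ j ≤ 0` — VACUOUS at the parents AND at the children — so at level 0 the
same-witness clause needs NO background proviso, only 12a″'s law at lengths `0` (reads no row) and `1` (K0's level-1 rows)), assembles the all-levels face (§2), and re-keys g0's
p600972 §2 on it (§3).  Net: on this road N11's displayed rows are K0's (`Provisos₁₃SepCoPH`, per-cube solvability inside `χ_j` + cube cover, levels `1…K`), the run's structure
(the window of length `K`, `PartCompat₁₃` up to `K`), the numerics (`2 ≤ cR`, `ε_j` in [B7] Prop. 2's range, cube side vs boxes), `0 < M₁ ≤ M`, and [III] §3's supplier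
(`SupplierObligations` + `SupplierBorel`) — NO reading-line primitive.

WHAT THIS FILE PROVES (6 theorems, 0 `sorry`, 0 `def`; nothing of Bałaban asserted).
§1 ★★ `clause_succ_sameWitness_zero_of_hasSect2FormAtZS_of_zhPin_of_solvable` — (γ′) AT LEVEL `k = 0` in the ZhPin class: from the CORE provisos, admissibility, `s2.Pos`, `0 < M₁`,
   `0 < K`, `1 ≤ M`, the window at `0`, `2 ≤ cR`, K0's LEVEL-1 rows and the named witness — no `BgProvisoΛ`, no `PartCompat₁₃`, no `hBt`, no `M₁ ≤ M` (FILE 9 with both provisos vacuous).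
§2 ★★★ `clause_succ_sameWitness_of_hasSect2FormAtZS_of_borelB_of_zhPin_of_solvable_all` — dag-n11-d's ★★★★★ WITHOUT `1 ≤ k` and WITHOUT `k + 1 ≤ m + K` (`K`-runs have `k + 1 ≤ K ≤ m + K`);
   every other hypothesis and the conclusion VERBATIM.
§3 ★★★ `noExpansionObligation_of_gaussCert_of_supplierBorel_of_solvable` ∕ ★★★ `supplyChainAt_of_gaussCert_of_supplierBorel_of_solvable` ∕ ★★★★
   `sLaw₁₃CoPH_all_of_obligations_of_gaussCert_of_supplierBorel_of_solvable` ∕ `thmP245Laws_of_gaussCert_of_supplierBorel_of_solvable` — g0 p600972 §2 RE-KEYED: at any Gaussian-class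
   `θ` with the SEPARATED-RANGE key `Provisos₁₃SepCoPH`, from `SupplierBorel` (+ `SupplierObligations` for THEOREM 1 ∕ the one-token residual ∕ the p. 245 laws), the run's window of
   length `K`, `PartCompat₁₃` up to `K`, `0 < M₁ ≤ M` (so `1 ≤ M`), `2 ≤ cR` and K0's rows at levels `1…K` — the (P)∕(V)∕`quad`∕measurability∕(K0b) binders discharged by the Gaussian
   class exactly as in g0.

HONEST FRAMING.  Helper lane of K1⁷; kernel composition; nothing of [III] ∕ [15] ∕ [B7] asserted — per-cube solvability, the cube cover, the numerics, `PartCompat₁₃`,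
`Provisos₁₃SepCoPH` and the supplier are HYPOTHESES (K0 ∕ def-R ∕ plan ∕ [III] §3 rows).  NO edition at the witness of record `theta13LiveOfRecord` is offered: there
`cR = 1` (`cR_theta13LiveOfRecord`) and `M = M₂ = 1`, so `2 ≤ cR` and the cover are UNINHABITED (dag-n11-d LOCATED g12) — the faces are for the all-numerics families
(`theta13LiveOfNumerics n ε₂₉`, dag-n11-e g19) where `cR`, `M`, `M₂` are letters.  N11 NOT discharged; K1⁷ NOT closed; counts unmoved (typed 28∕28 · discharged 5∕27).
R4 closes only the conditional finite-𝕋⁴ rung `BalabanLadder.UV` of one programme at fixed `ε = L^{−K}` — NOT ℝ⁴, NOT OS, NOT a mass gap, NOT Clay.  No `sorry`, `axiom`, `def`,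
`instance`, `notation`.  Sources (SHAPE only): [III] Theorem p.245, Thm 1 p.262, §3 p.279, (2.1)–(2.2) pp.254–255, (2.10) p.256, (2.16)–(2.18) p.257, (2.20)–(2.28) pp.258–259,
(2.41)–(2.42) p.261, (3.5) p.265, (3.16) p.268, (3.24)–(3.25) p.270; [15] Thm 1 (7)–(8) pp.278–279; [B7] Prop. 2 p.26; [6] (1.3)–(1.6) p.77; [Balaban1989LargeFieldI] (0.2)–(0.4)
p.176, p.177 (i)–(ii).
-/

noncomputable section

open MeasureTheory
open scoped BigOperators ENNReal NNReal Matrix.Norms.L2Operator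

namespace Summit.QuantumFields.YangMills.Theorems.BalabanUVNodesN11Sect3SupplyChainBorelBObligationsOfSolvable

open Literature.MathematicalPhysics.QuantumFieldTheory.Balaban1983to89 T4Continuum T4NestedCovariance Node00 Node00.Tk DagBinding
open B15DeterminingSets B8Eq17ClassAkV1 B14.Eq218Concrete B10Eq42TorusConstraint Step
open B14.Eq213MaximalDomains (side)
open B14.Eq213DetSet (Bj)
open Literature.MathematicalPhysics.QuantumFieldTheory.BalabanImbrieJaffe1984to88.BIJ85Eq453GaugeField (qsstarGIter0)
open BalabanUVNodesN11FluctTruncationDefs (IsFluctLocal)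
open BalabanUVNodesN11SpaceTruncationDefs BalabanUVNodesN11SpaceTruncationBorelBDefs
open BalabanUVNodesN11HistoryPinnedResidualDefs BalabanUVNodesN11RePinnedParamDefs
open BalabanUVNodesN11NoExpansionTStepZhPinOfSolvable (regOn_cutSel_of_zhPin_of_solvable)
open BalabanUVNodesN11SpaceTruncationSameWitnessFibre (clause_succ_sameWitness_of_hasSect2FormAtZS_of_borelB_of_bgReadChargedFibre)
open BalabanUVNodesN11SameWitnessZhPinOfSolvable (clause_succ_sameWitness_of_hasSect2FormAtZS_of_borelB_of_zhPin_of_solvable)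
open BalabanUVNodesN11GaussianCertificateRows
open BalabanUVNodesN11Sect3SupplyChainDefs
open BalabanUVNodesN11Sect3SupplyChainBorelB
open BalabanUVNodesN11Sect3SupplyChainObligationsDefs
open BalabanUVNodesN11Sect3SupplyChainBorelBObligations (borelB_chainWitness_pos_of_supplierBorel)
open BalabanUVNodesN11AFibreDominationOfCoercive (afibre_rows_adm_of_coercive)

variable {F : T4Family} {N : ℕ} [NeZero N]

/-! ## §1  ★★ The LEVEL-`0` same-witness clause in the ZhPin class: no background proviso, no `PartCompat₁₃`, no `hBt` -/

section Zero

variable (θ : Stage13HParams F N) (p : B12.RunParams)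

/-- **★★ (γ′) AT LEVEL `k = 0` IN THE ZhPin CLASS — NO BACKGROUND PROVISO AT ALL.**  def-R's ranged proviso `BgProvisoΛ … n …` quantifies the scales `1 ≤ j ≤ n`; at the
parents (length `0`) AND at the children (dag-n11-d's FILE 9 reads the CHILD's level-`1` background at the proviso index `k = 0`) it is VACUOUS, and so are the Borel rows
`hBt` on `[1, 0]` and every level-`j < 0` clause.  What remains of FILE 9's hypotheses: the core provisos, `ZhUnity` (the class, `zhUnity_of_gaussCert`), admissibility,
`s2.Pos`, `0 < K`, `1 ≤ M`, the window at `0`, 12a″'s `RegOn` at lengths `0` and `1` — THEOREMS on the cut selector by dag-n11-d's `regOn_cutSel_of_zhPin_of_solvable`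
from `2 ≤ cR`, `0 < M₁` and K0's LEVEL-1 rows (per-cube [15]-solvability inside `χ₁`, the cube cover of `Ω₁`, `ε₁` in [B7] Prop. 2's range, cube side vs boxes; length `0`
reads no row) — and the named witness `(t₀, E₀)` of `ρ₀`'s §2 form.  Conclusion VERBATIM dag-n11-d's (γ′) at `k = 0`.
[cite: Balaban1988Convergent, Theorem p.245, Thm 1 p.262, (2.10) p.256, (2.16)–(2.18) p.257, (2.20)–(2.28) pp.258–259, (3.16) p.268, (3.24)–(3.25) p.270; Balaban1985Variational, Thm 1 (7)–(8) pp.278–279; Balaban1985Averaging, Prop. 2 p.26] -/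
theorem clause_succ_sameWitness_zero_of_hasSect2FormAtZS_of_zhPin_of_solvable
    (hζ0 : ∀ (p' : B12.RunParams) (n : ℕ) (Ω Λ : ℕ → Set (Site (F.P p'.K) 0)), (θ.Zh p' n Ω Λ).ζ0 = (ZhPinOfRecord₁₃ θ.toStage13Params p' Ω Λ).ζ0)
    (h : θ.Provisos₁₃CoPH F N) (hθ : θ.Admissible F N) (hpos : θ.s2.Pos) (hM₁ : 0 < θ.ν.M₁) (hK : 0 < p.K) (hM : 1 ≤ θ.τ9.M)
    (hw : Step.InInterval θ.γ 0 (gOfRecord₁₃ F N θ.toStage13Params p)) (hcR : 2 ≤ θ.s2.cR)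
    (h3 : 3 * side (F.P p.K).L θ.ν.M₁ 1 ≤ cubeSide (F.P p.K).L θ.ν.M₂ (RkOfRecord (F.P p.K).L θ.ν.r (gOfRecord₁₃ F N θ.toStage13Params p 1)) 1)
    (hR : (F.P p.K).L ^ 1 + (((F.P p.K).d + 4) * (F.P p.K).L + 2) * (∑ l ∈ Finset.range 1, (F.P p.K).L ^ l) + 2 ≤
      cubeSide (F.P p.K).L θ.ν.M₂ (RkOfRecord (F.P p.K).L θ.ν.r (gOfRecord₁₃ F N θ.toStage13Params p 1)) 1)
    (hε : 0 < epsOfRecord θ.ν (gOfRecord₁₃ F N θ.toStage13Params p) 1)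
    (hε3 : (143 * (((((F.P p.K).d + 4 : ℕ) : ℝ)) ^ 2 / 4) ^ 2) * epsOfRecord θ.ν (gOfRecord₁₃ F N θ.toStage13Params p) 1 ≤ 1 / 3)
    (hε2 : 2 * epsOfRecord θ.ν (gOfRecord₁₃ F N θ.toStage13Params p) 1 ≤ 2 * ExpMeanLog.deltaSU (Fin N) / ((((F.P p.K).d + 4) * (F.P p.K).L : ℕ) : ℝ) ^ 2)
    (hsolv : ∀ (s : SeqOfRecord F θ.ν θ.τ9.M (gOfRecord₁₃ F N θ.toStage13Params p) p.K 1) (V : GaugeField (F.P p.K) 1 (SU N)),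
      chiSeqOfRecord F N θ.ν θ.τ9.M (gOfRecord₁₃ F N θ.toStage13Params p) p.K 1 s V ≠ 0 →
      ∀ a ∈ cubesIn (fun a : ↥(cubeIndices (F.P p.K) (cubeSide (F.P p.K).L θ.ν.M₂ (RkOfRecord (F.P p.K).L θ.ν.r (gOfRecord₁₃ F N θ.toStage13Params p 1)) 1)) =>
          cubeEnl (F.P p.K) (cubeSide (F.P p.K).L θ.ν.M₂ (RkOfRecord (F.P p.K).L θ.ν.r (gOfRecord₁₃ F N θ.toStage13Params p 1)) 1) a 0) (s.Ω 1),
        ∃ U₀, IsMinimizer (avOfRecord F N p.K) {U | PlaqSmall (θ.ν.εreg * (F.P p.K).eta 1 ^ 2) U}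
          (Bj θ.ν.M₁ (cubeEnl (F.P p.K) (cubeSide (F.P p.K).L θ.ν.M₂ (RkOfRecord (F.P p.K).L θ.ν.r (gOfRecord₁₃ F N θ.toStage13Params p 1)) 1) a 4) 1)
          (avgFamily (avOfRecord F N p.K) (qsstarGIter0 1 V)) U₀)
    (hcov : ∀ s : SeqOfRecord F θ.ν θ.τ9.M (gOfRecord₁₃ F N θ.toStage13Params p) p.K 1,
      s.Ω 1 ⊆ ⋃ a ∈ cubesIn (fun a : ↥(cubeIndices (F.P p.K) (cubeSide (F.P p.K).L θ.ν.M₂ (RkOfRecord (F.P p.K).L θ.ν.r (gOfRecord₁₃ F N θ.toStage13Params p 1)) 1)) =>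
          cubeEnl (F.P p.K) (cubeSide (F.P p.K).L θ.ν.M₂ (RkOfRecord (F.P p.K).L θ.ν.r (gOfRecord₁₃ F N θ.toStage13Params p 1)) 1) a 0) (s.Ω 1),
        cubeEnl (F.P p.K) (cubeSide (F.P p.K).L θ.ν.M₂ (RkOfRecord (F.P p.K).L θ.ν.r (gOfRecord₁₃ F N θ.toStage13Params p 1)) 1) a 0)
    (t₀ : SeqOfRecord F θ.ν θ.τ9.M (gOfRecord₁₃ F N θ.toStage13Params p) p.K 0 → Sect2.TermValues (F.P p.K) (MatA N) (FluctV N) θ.τ9.M)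
    (E₀ : SeqOfRecord F θ.ν θ.τ9.M (gOfRecord₁₃ F N θ.toStage13Params p) p.K 0 → ℝ)
    (hform₀ : HasSect2FormAtZS F N (FluctV N) p.K (settingOfRecord₁₃ F N θ.toStage13Params p) 0 (θ.rzAt p) (WtOfRecord₁₃H F N θ p)
      (UbgOfRecord₁₃CoP F N θ.toStage13Params p 0)
      (fun s₀ t' => Sect2.LawsRT (sect2TowerOfRecord F N (FluctV N) p.K (settingOfRecord₁₃ F N θ.toStage13Params p) (θ.rzAt p s₀) s₀ t')
        (settingOfRecord₁₃ F N θ.toStage13Params p).lf 0)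
      (slotsOfRecord F N θ.ν θ.τ9 (EOfRecord₁₃ F N θ.toStage13Params) (wOfRecord₉ F N θ.toStage9Params) θ.ppSel p (gOfRecord₁₃ F N θ.toStage13Params p) 0) t₀ E₀) :
    ∀ (s : SeqOfRecord F θ.ν θ.τ9.M (gOfRecord₁₃ F N θ.toStage13Params p) p.K (0 + 1)), s.Ω (0 + 1) = ∅ →
        (∀ j, j < 0 → (θ.zhAt p s).ζ0 j = (θ.zhAt p s.init).ζ0 j ∧ (θ.zhAt p s).quad j = (θ.zhAt p s.init).quad j) →
        (∀ (V' : GaugeField (F.P p.K) (0 + 1) (SU N)) (U₀ : GaugeField (F.P p.K) 0 (SU N)),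
          (θ.zhAt p s).ζ0 0 Set.univ (pairCfgAt (V := FluctV N) 0 V' U₀) =
            chiSeqOfRecord F N θ.ν θ.τ9.M (gOfRecord₁₃ F N θ.toStage13Params p) p.K 0 s.init U₀ *
              wOfRecord₉ F N θ.toStage9Params p (gOfRecord₁₃ F N θ.toStage13Params p) 0 s U₀ ((avOfRecord F N p.K 0).avg U₀)) →
        (∀ (V' : GaugeField (F.P p.K) (0 + 1) (SU N)) (U₀ : GaugeField (F.P p.K) 0 (SU N)), (θ.zhAt p s).quad 0 ∅ (pairCfgAt (V := FluctV N) 0 V' U₀) = 0) →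
        (∀ j, j < 0 → ∀ ω ω' : MultiCfg (F.P p.K) (SU N) (FluctV N), (∀ i, i ≤ 0 → ω i = ω' i) →
          (θ.zhAt p s).quad j (s.init.Λ (j + 1)) ω = (θ.zhAt p s).quad j (s.init.Λ (j + 1)) ω') →
        (∀ j (Y : Set (Site (F.P p.K) 0)), Measurable ((θ.zhAt p s).ζ0 j Y)) →
        (∀ j (Λ' : Set (Site (F.P p.K) 0)), Measurable ((θ.zhAt p s).quad j Λ')) →
        (∀ S ∈ admSOfRecord F θ.ν θ.τ9.M (gOfRecord₁₃ F N θ.toStage13Params p) p.K 0 s.init, ∀ j : ℕ,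
          ∃ ŵ : (↥(Set.toFinite (B10Eq42TorusConstraint.bondsIn j ((s.init.Λ (j + 1))ᶜ ∩ s.init.Ω (j + 1)))).toFinset → FluctV N) → ℝ≥0∞, Measurable ŵ ∧
            (∫⁻ a, ŵ a ∂(Measure.pi fun _ : ↥(Set.toFinite (B10Eq42TorusConstraint.bondsIn j ((s.init.Λ (j + 1))ᶜ ∩ s.init.Ω (j + 1)))).toFinset => (volume : Measure (FluctV N)))) ≠ ⊤ ∧
            ∀ ω, ENNReal.ofReal ((WtOfRecord₁₃H F N θ p s).w j (s.init.Λ (j + 1)) ((s.init.Λ (j + 1))ᶜ ∩ s.init.Ω (j + 1)) (S (j + 1)) ω) ≤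
              ŵ (fun b : ↥(Set.toFinite (B10Eq42TorusConstraint.bondsIn j ((s.init.Λ (j + 1))ᶜ ∩ s.init.Ω (j + 1)))).toFinset => (ω j).2 b)) →
        (slotsTOfRecord F N θ.ν θ.τ9 (EOfRecord₁₃ F N θ.toStage13Params) (wOfRecord₉ F N θ.toStage9Params) θ.ppSel p
            (gOfRecord₁₃ F N θ.toStage13Params p) (0 + 1) s = 0 ∨
          ∀ᵐ V' ∂fieldMeasure (F.P p.K) (0 + 1) (SU N),
            chiSeqOfRecord F N θ.ν θ.τ9.M (gOfRecord₁₃ F N θ.toStage13Params p) p.K (0 + 1) s V' ≠ 0 →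
              slotsTOfRecord F N θ.ν θ.τ9 (EOfRecord₁₃ F N θ.toStage13Params) (wOfRecord₉ F N θ.toStage9Params) θ.ppSel p
                  (gOfRecord₁₃ F N θ.toStage13Params p) (0 + 1) s V' =
                sect2Slot F N (FluctV N) p.K (settingOfRecord₁₃ F N θ.toStage13Params p) (θ.rzAt p s) (WtOfRecord₁₃H F N θ p s) s
                  (t₀ s.init) (E₀ s.init) (UbgOfRecord₁₃CoP F N θ.toStage13Params p (0 + 1) s) V') := by
  have hkm : 1 ≤ (F.P p.K).m + (F.P p.K).K := le_add_right F.hm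
  refine clause_succ_sameWitness_of_hasSect2FormAtZS_of_borelB_of_bgReadChargedFibre θ p h (zhUnity_of_gaussCert θ hζ0) hθ hpos hK hM hw θ.s2.cR
    (fun s₀ j Y => {x | (j < 0 ∧ Y = (s₀.Ω (j + 1))ᶜ) ∧ x ∈ readSelOfSeq F p (suppDomOfRecord F θ.ν p.K s₀.Ω) s₀.Ω j Y})
    (fun s₀ => regOn_cutSel_of_zhPin_of_solvable θ p hζ0 (Nat.zero_le _) (Nat.zero_le _) hcR hM₁ (fun j h1 hj => absurd (h1.trans hj) (Nat.not_succ_le_zero 0))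
      (fun j h1 hj => absurd (h1.trans hj) (Nat.not_succ_le_zero 0)) (fun j h1 hj => absurd (h1.trans hj) (Nat.not_succ_le_zero 0))
      (fun j h1 hj => absurd (h1.trans hj) (Nat.not_succ_le_zero 0)) (fun j h1 hj => absurd (h1.trans hj) (Nat.not_succ_le_zero 0))
      (fun j h1 hj => absurd (h1.trans hj) (Nat.not_succ_le_zero 0)) (fun j h1 hj => absurd (h1.trans hj) (Nat.not_succ_le_zero 0)) s₀)
    (fun _ _ _ j h1 hj _ => absurd (h1.trans hj) (Nat.not_succ_le_zero 0)) t₀ E₀ hform₀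
    (fun _ _ j _ h1 hj => absurd (h1.trans hj) (Nat.not_succ_le_zero 0))
    (fun s j Y => {x | (j < 0 + 1 ∧ Y = (s.Ω (j + 1))ᶜ) ∧ x ∈ readSelOfSeq F p (suppDomOfRecord F θ.ν p.K s.Ω) s.Ω j Y})
    (fun s => regOn_cutSel_of_zhPin_of_solvable θ p hζ0 hK hkm hcR hM₁ (fun j h1 hj => by obtain rfl : j = 1 := le_antisymm hj h1; exact h3)
      (fun j h1 hj => by obtain rfl : j = 1 := le_antisymm hj h1; exact hR) (fun j h1 hj => by obtain rfl : j = 1 := le_antisymm hj h1; exact hε)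
      (fun j h1 hj => by obtain rfl : j = 1 := le_antisymm hj h1; exact hε3) (fun j h1 hj => by obtain rfl : j = 1 := le_antisymm hj h1; exact hε2)
      (fun j h1 hj => by obtain rfl : j = 1 := le_antisymm hj h1; exact hsolv) (fun j h1 hj => by obtain rfl : j = 1 := le_antisymm hj h1; exact hcov) s)
    fun _ _ _ j h1 hj _ => absurd (h1.trans hj) (Nat.not_succ_le_zero 0)

end Zero

/-! ## §2  ★★★ dag-n11-d's same-witness face at EVERY level `k < K` (no `1 ≤ k`, no `k + 1 ≤ m + K`) -/

section All

variable (θ : Stage13HParams F N) (p : B12.RunParams)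

/-- **★★★ (γ′) THE SAME-WITNESS NO-EXPANSION 𝐓-STEP CLAUSE IN THE ZhPin CLASS AT EVERY LEVEL `k < K`** — dag-n11-d's ★★★★★
`clause_succ_sameWitness_of_hasSect2FormAtZS_of_borelB_of_zhPin_of_solvable` (levels `1 ≤ k`) and §1 (level `0`) glued; the row `k + 1 ≤ m + K` is discharged (`k + 1 ≤ K ≤ m + K`
for a `K`-run).  Rows: `Provisos₁₃SepCoPH θ` (its `bg` is read at `1 ≤ k` only), `Admissible`, `s2.Pos`, `0 < M₁ ≤ M`, `1 ≤ M`, the windows and `PartCompat₁₃` at `k` and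
`k+1`, `2 ≤ cR`, and per level `1 ≤ j ≤ k+1` K0's per-cube [15]-solvability inside `χ_j`, the cube cover of `Ω_j`, the numerics; the named witness `hform₀` with Borel
𝐁-terms `hBt` on `[1, k]`.  Conclusion VERBATIM dag-n11-d's. [cite: Balaban1988Convergent, Theorem p.245, Thm 1 p.262, (2.1)–(2.2) pp.254–255, (2.10) p.256, (2.16)–(2.18) p.257, (2.20)–(2.28) pp.258–259, (2.41)–(2.42) p.261, (3.5) p.265, (3.16) p.268, (3.24)–(3.25) p.270; Balaban1985Variational, Thm 1 (7)–(8) pp.278–279; Balaban1985Averaging, Prop. 2 p.26; Balaban1985RegularSpaces, (1.3)–(1.6) p.77] -/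
theorem clause_succ_sameWitness_of_hasSect2FormAtZS_of_borelB_of_zhPin_of_solvable_all
    (hζ0 : ∀ (p' : B12.RunParams) (n : ℕ) (Ω Λ : ℕ → Set (Site (F.P p'.K) 0)), (θ.Zh p' n Ω Λ).ζ0 = (ZhPinOfRecord₁₃ θ.toStage13Params p' Ω Λ).ζ0)
    (h : θ.Provisos₁₃SepCoPH F N) (hθ : θ.Admissible F N)
    (hpos : θ.s2.Pos) (hM₁ : 0 < θ.ν.M₁) (hle : θ.ν.M₁ ≤ θ.τ9.M) {k : ℕ} (hk : k < p.K) (hM : 1 ≤ θ.τ9.M)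
    (hw : Step.InInterval θ.γ k (gOfRecord₁₃ F N θ.toStage13Params p)) (hPC : PartCompat₁₃ F N θ.toStage13Params p k)
    (hw' : Step.InInterval θ.γ (k + 1) (gOfRecord₁₃ F N θ.toStage13Params p)) (hPC' : PartCompat₁₃ F N θ.toStage13Params p (k + 1)) (hcR : 2 ≤ θ.s2.cR)
    (h3 : ∀ j, 1 ≤ j → j ≤ k + 1 →
      3 * side (F.P p.K).L θ.ν.M₁ j ≤ cubeSide (F.P p.K).L θ.ν.M₂ (RkOfRecord (F.P p.K).L θ.ν.r (gOfRecord₁₃ F N θ.toStage13Params p j)) j)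
    (hR : ∀ j, 1 ≤ j → j ≤ k + 1 → (F.P p.K).L ^ j + (((F.P p.K).d + 4) * (F.P p.K).L + 2) * (∑ l ∈ Finset.range j, (F.P p.K).L ^ l) + 2 ≤
      cubeSide (F.P p.K).L θ.ν.M₂ (RkOfRecord (F.P p.K).L θ.ν.r (gOfRecord₁₃ F N θ.toStage13Params p j)) j)
    (hε : ∀ j, 1 ≤ j → j ≤ k + 1 → 0 < epsOfRecord θ.ν (gOfRecord₁₃ F N θ.toStage13Params p) j)
    (hε3 : ∀ j, 1 ≤ j → j ≤ k + 1 → (143 * (((((F.P p.K).d + 4 : ℕ) : ℝ)) ^ 2 / 4) ^ 2) * epsOfRecord θ.ν (gOfRecord₁₃ F N θ.toStage13Params p) j ≤ 1 / 3)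
    (hε2 : ∀ j, 1 ≤ j → j ≤ k + 1 →
      2 * epsOfRecord θ.ν (gOfRecord₁₃ F N θ.toStage13Params p) j ≤ 2 * ExpMeanLog.deltaSU (Fin N) / ((((F.P p.K).d + 4) * (F.P p.K).L : ℕ) : ℝ) ^ 2)
    (hsolv : ∀ j, 1 ≤ j → j ≤ k + 1 → ∀ (s : SeqOfRecord F θ.ν θ.τ9.M (gOfRecord₁₃ F N θ.toStage13Params p) p.K j) (V : GaugeField (F.P p.K) j (SU N)),
      chiSeqOfRecord F N θ.ν θ.τ9.M (gOfRecord₁₃ F N θ.toStage13Params p) p.K j s V ≠ 0 →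
      ∀ a ∈ cubesIn (fun a : ↥(cubeIndices (F.P p.K) (cubeSide (F.P p.K).L θ.ν.M₂ (RkOfRecord (F.P p.K).L θ.ν.r (gOfRecord₁₃ F N θ.toStage13Params p j)) j)) =>
          cubeEnl (F.P p.K) (cubeSide (F.P p.K).L θ.ν.M₂ (RkOfRecord (F.P p.K).L θ.ν.r (gOfRecord₁₃ F N θ.toStage13Params p j)) j) a 0) (s.Ω j),
        ∃ U₀, IsMinimizer (avOfRecord F N p.K) {U | PlaqSmall (θ.ν.εreg * (F.P p.K).eta j ^ 2) U}
          (Bj θ.ν.M₁ (cubeEnl (F.P p.K) (cubeSide (F.P p.K).L θ.ν.M₂ (RkOfRecord (F.P p.K).L θ.ν.r (gOfRecord₁₃ F N θ.toStage13Params p j)) j) a 4) j)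
          (avgFamily (avOfRecord F N p.K) (qsstarGIter0 j V)) U₀)
    (hcov : ∀ j, 1 ≤ j → j ≤ k + 1 → ∀ s : SeqOfRecord F θ.ν θ.τ9.M (gOfRecord₁₃ F N θ.toStage13Params p) p.K j,
      s.Ω j ⊆ ⋃ a ∈ cubesIn (fun a : ↥(cubeIndices (F.P p.K) (cubeSide (F.P p.K).L θ.ν.M₂ (RkOfRecord (F.P p.K).L θ.ν.r (gOfRecord₁₃ F N θ.toStage13Params p j)) j)) =>
          cubeEnl (F.P p.K) (cubeSide (F.P p.K).L θ.ν.M₂ (RkOfRecord (F.P p.K).L θ.ν.r (gOfRecord₁₃ F N θ.toStage13Params p j)) j) a 0) (s.Ω j),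
        cubeEnl (F.P p.K) (cubeSide (F.P p.K).L θ.ν.M₂ (RkOfRecord (F.P p.K).L θ.ν.r (gOfRecord₁₃ F N θ.toStage13Params p j)) j) a 0)
    (t₀ : SeqOfRecord F θ.ν θ.τ9.M (gOfRecord₁₃ F N θ.toStage13Params p) p.K k → Sect2.TermValues (F.P p.K) (MatA N) (FluctV N) θ.τ9.M)
    (E₀ : SeqOfRecord F θ.ν θ.τ9.M (gOfRecord₁₃ F N θ.toStage13Params p) p.K k → ℝ)
    (hform₀ : HasSect2FormAtZS F N (FluctV N) p.K (settingOfRecord₁₃ F N θ.toStage13Params p) k (θ.rzAt p) (WtOfRecord₁₃H F N θ p)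
      (UbgOfRecord₁₃CoP F N θ.toStage13Params p k)
      (fun s₀ t' => Sect2.LawsRT (sect2TowerOfRecord F N (FluctV N) p.K (settingOfRecord₁₃ F N θ.toStage13Params p) (θ.rzAt p s₀) s₀ t')
        (settingOfRecord₁₃ F N θ.toStage13Params p).lf k)
      (slotsOfRecord F N θ.ν θ.τ9 (EOfRecord₁₃ F N θ.toStage13Params) (wOfRecord₉ F N θ.toStage9Params) θ.ppSel p (gOfRecord₁₃ F N θ.toStage13Params p) k) t₀ E₀)
    (hBt : ∀ s₀ (S' : ℕ → Set (Site (F.P p.K) 0)) (j : ℕ) (X : (Sect2.domSys (F.P p.K) θ.τ9.M j).Dom), 1 ≤ j → j ≤ k →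
      Measurable (fun q : GaugeField (F.P p.K) 0 (SU N) × MSFluct (F.P p.K) (FluctV N) =>
        (t₀ s₀).B j X (Sect2.ofBackgroundC (settingOfRecord₁₃ F N θ.toStage13Params p).ι q.1) (S', q.2))) :
    ∀ (s : SeqOfRecord F θ.ν θ.τ9.M (gOfRecord₁₃ F N θ.toStage13Params p) p.K (k + 1)), s.Ω (k + 1) = ∅ →
        (∀ j, j < k → (θ.zhAt p s).ζ0 j = (θ.zhAt p s.init).ζ0 j ∧ (θ.zhAt p s).quad j = (θ.zhAt p s.init).quad j) →
        (∀ (V' : GaugeField (F.P p.K) (k + 1) (SU N)) (U₀ : GaugeField (F.P p.K) k (SU N)),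
          (θ.zhAt p s).ζ0 k Set.univ (pairCfgAt (V := FluctV N) k V' U₀) =
            chiSeqOfRecord F N θ.ν θ.τ9.M (gOfRecord₁₃ F N θ.toStage13Params p) p.K k s.init U₀ *
              wOfRecord₉ F N θ.toStage9Params p (gOfRecord₁₃ F N θ.toStage13Params p) k s U₀ ((avOfRecord F N p.K k).avg U₀)) →
        (∀ (V' : GaugeField (F.P p.K) (k + 1) (SU N)) (U₀ : GaugeField (F.P p.K) k (SU N)), (θ.zhAt p s).quad k ∅ (pairCfgAt (V := FluctV N) k V' U₀) = 0) →
        (∀ j, j < k → ∀ ω ω' : MultiCfg (F.P p.K) (SU N) (FluctV N), (∀ i, i ≤ k → ω i = ω' i) →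
          (θ.zhAt p s).quad j (s.init.Λ (j + 1)) ω = (θ.zhAt p s).quad j (s.init.Λ (j + 1)) ω') →
        (∀ j (Y : Set (Site (F.P p.K) 0)), Measurable ((θ.zhAt p s).ζ0 j Y)) →
        (∀ j (Λ' : Set (Site (F.P p.K) 0)), Measurable ((θ.zhAt p s).quad j Λ')) →
        (∀ S ∈ admSOfRecord F θ.ν θ.τ9.M (gOfRecord₁₃ F N θ.toStage13Params p) p.K k s.init, ∀ j : ℕ,
          ∃ ŵ : (↥(Set.toFinite (B10Eq42TorusConstraint.bondsIn j ((s.init.Λ (j + 1))ᶜ ∩ s.init.Ω (j + 1)))).toFinset → FluctV N) → ℝ≥0∞, Measurable ŵ ∧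
            (∫⁻ a, ŵ a ∂(Measure.pi fun _ : ↥(Set.toFinite (B10Eq42TorusConstraint.bondsIn j ((s.init.Λ (j + 1))ᶜ ∩ s.init.Ω (j + 1)))).toFinset => (volume : Measure (FluctV N)))) ≠ ⊤ ∧
            ∀ ω, ENNReal.ofReal ((WtOfRecord₁₃H F N θ p s).w j (s.init.Λ (j + 1)) ((s.init.Λ (j + 1))ᶜ ∩ s.init.Ω (j + 1)) (S (j + 1)) ω) ≤
              ŵ (fun b : ↥(Set.toFinite (B10Eq42TorusConstraint.bondsIn j ((s.init.Λ (j + 1))ᶜ ∩ s.init.Ω (j + 1)))).toFinset => (ω j).2 b)) →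
        (slotsTOfRecord F N θ.ν θ.τ9 (EOfRecord₁₃ F N θ.toStage13Params) (wOfRecord₉ F N θ.toStage9Params) θ.ppSel p
            (gOfRecord₁₃ F N θ.toStage13Params p) (k + 1) s = 0 ∨
          ∀ᵐ V' ∂fieldMeasure (F.P p.K) (k + 1) (SU N),
            chiSeqOfRecord F N θ.ν θ.τ9.M (gOfRecord₁₃ F N θ.toStage13Params p) p.K (k + 1) s V' ≠ 0 →
              slotsTOfRecord F N θ.ν θ.τ9 (EOfRecord₁₃ F N θ.toStage13Params) (wOfRecord₉ F N θ.toStage9Params) θ.ppSel p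
                  (gOfRecord₁₃ F N θ.toStage13Params p) (k + 1) s V' =
                sect2Slot F N (FluctV N) p.K (settingOfRecord₁₃ F N θ.toStage13Params p) (θ.rzAt p s) (WtOfRecord₁₃H F N θ p s) s
                  (t₀ s.init) (E₀ s.init) (UbgOfRecord₁₃CoP F N θ.toStage13Params p (k + 1) s) V') := by
  cases k with
  | zero =>
    exact clause_succ_sameWitness_zero_of_hasSect2FormAtZS_of_zhPin_of_solvable θ p hζ0 h.toCore hθ hpos hM₁ hk hM hw hcR (h3 1 le_rfl le_rfl)
      (hR 1 le_rfl le_rfl) (hε 1 le_rfl le_rfl) (hε3 1 le_rfl le_rfl) (hε2 1 le_rfl le_rfl) (hsolv 1 le_rfl le_rfl) (hcov 1 le_rfl le_rfl) t₀ E₀ hform₀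
  | succ k =>
    have hkm : k + 1 + 1 ≤ (F.P p.K).m + (F.P p.K).K := (Nat.succ_le_of_lt hk).trans (Nat.le_add_left _ _)
    exact clause_succ_sameWitness_of_hasSect2FormAtZS_of_borelB_of_zhPin_of_solvable θ p hζ0 h hθ hpos hM₁ hle hk hM hw hPC hw' hPC' (Nat.succ_pos k) hkm hcR
      h3 hR hε hε3 hε2 hsolv hcov t₀ E₀ hform₀ hBt

end All

/-! ## §3  ★★★ `NoExpansionObligation` ∕ ★★★★ THEOREM 1 along the chain at a Gaussian certificate — from `SupplierBorel`, K0's rows and the run's structure only -/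

section Obligation

variable (θ : Stage13HParams F N) (p : B12.RunParams)

/-- **★★★ `NoExpansionObligation θ p σ` AT ANY `θ` OF THE GAUSSIAN CERTIFICATE CLASS — NO READING-LINE PRIMITIVE** (g0's W1-X1 (iii) face RE-KEYED): §2 at the chain's
level-`k` witness (its `hBt` on `[1, k]` by g0's `borelB_chainWitness_pos_of_supplierBorel`), with the (P) ∕ (V) ∕ `quad_k(∅) = 0` ∕ locality ∕ measurability ∕ (K0b)
binders DISCHARGED by the Gaussian class (`…GaussianCertificateRows` §1 + dag-n11-w4's `afibre_rows_adm_of_coercive`).  DISPLAYED: the separated-range key `Provisos₁₃SepCoPH θ`,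
admissibility (`s2.Pos` read off it), `0 < M₁ ≤ M` (so `1 ≤ M`), `2 ≤ cR`, the run's window up to `K` (every shorter window follows), `PartCompat₁₃` up to `K`, K0's per-cube [15]-solvability + cube cover +
numerics at levels `1…K`, and `SupplierBorel`.  No `RegOn`, no `BgProvisoΛ`, no operand row, no term bound, no `BaseBorel`.
[cite: Balaban1988Convergent, Theorem p.245, Thm 1 p.262, §3 p.279, (3.24)–(3.25) p.270, (2.10) p.256, (2.16)–(2.18) p.257, (2.27)–(2.28) p.259; Balaban1985Variational, Thm 1 (7)–(8) pp.278–279; Balaban1985Averaging, Prop. 2 p.26] -/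
theorem noExpansionObligation_of_gaussCert_of_supplierBorel_of_solvable
    (hζ : ∀ (p' : B12.RunParams) (n : ℕ) (Ω Λ : ℕ → Set (Site (F.P p'.K) 0)), (θ.Zh p' n Ω Λ).ζ0 = (ZhPinOfRecord₁₃ θ.toStage13Params p' Ω Λ).ζ0)
    (hq : ∀ (p' : B12.RunParams) (n : ℕ) (Ω Λ : ℕ → Set (Site (F.P p'.K) 0)) (j : ℕ) (Λ' : Set (Site (F.P p'.K) 0)) (ω : MultiCfg (F.P p'.K) (SU N) (FluctV N)),
      (θ.Zh p' n Ω Λ).quad j Λ' ω = ∑ b ∈ (Set.toFinite (bondsIn j (Λ'ᶜ ∩ Ω (j + 1)))).toFinset, ‖(ω j).2 b‖ ^ 2)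
    (h : θ.Provisos₁₃SepCoPH F N) (hθ : θ.Admissible F N) (hM₁ : 0 < θ.ν.M₁) (hle : θ.ν.M₁ ≤ θ.τ9.M) (hcR : 2 ≤ θ.s2.cR)
    (hw : Step.InInterval θ.γ p.K (gOfRecord₁₃ F N θ.toStage13Params p)) (hPC : PartCompat₁₃ F N θ.toStage13Params p p.K)
    (h3 : ∀ j, 1 ≤ j → j ≤ p.K →
      3 * side (F.P p.K).L θ.ν.M₁ j ≤ cubeSide (F.P p.K).L θ.ν.M₂ (RkOfRecord (F.P p.K).L θ.ν.r (gOfRecord₁₃ F N θ.toStage13Params p j)) j)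
    (hR : ∀ j, 1 ≤ j → j ≤ p.K → (F.P p.K).L ^ j + (((F.P p.K).d + 4) * (F.P p.K).L + 2) * (∑ l ∈ Finset.range j, (F.P p.K).L ^ l) + 2 ≤
      cubeSide (F.P p.K).L θ.ν.M₂ (RkOfRecord (F.P p.K).L θ.ν.r (gOfRecord₁₃ F N θ.toStage13Params p j)) j)
    (hε : ∀ j, 1 ≤ j → j ≤ p.K → 0 < epsOfRecord θ.ν (gOfRecord₁₃ F N θ.toStage13Params p) j)
    (hε3 : ∀ j, 1 ≤ j → j ≤ p.K → (143 * (((((F.P p.K).d + 4 : ℕ) : ℝ)) ^ 2 / 4) ^ 2) * epsOfRecord θ.ν (gOfRecord₁₃ F N θ.toStage13Params p) j ≤ 1 / 3)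
    (hε2 : ∀ j, 1 ≤ j → j ≤ p.K →
      2 * epsOfRecord θ.ν (gOfRecord₁₃ F N θ.toStage13Params p) j ≤ 2 * ExpMeanLog.deltaSU (Fin N) / ((((F.P p.K).d + 4) * (F.P p.K).L : ℕ) : ℝ) ^ 2)
    (hsolv : ∀ j, 1 ≤ j → j ≤ p.K → ∀ (s : SeqOfRecord F θ.ν θ.τ9.M (gOfRecord₁₃ F N θ.toStage13Params p) p.K j) (V : GaugeField (F.P p.K) j (SU N)),
      chiSeqOfRecord F N θ.ν θ.τ9.M (gOfRecord₁₃ F N θ.toStage13Params p) p.K j s V ≠ 0 →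
      ∀ a ∈ cubesIn (fun a : ↥(cubeIndices (F.P p.K) (cubeSide (F.P p.K).L θ.ν.M₂ (RkOfRecord (F.P p.K).L θ.ν.r (gOfRecord₁₃ F N θ.toStage13Params p j)) j)) =>
          cubeEnl (F.P p.K) (cubeSide (F.P p.K).L θ.ν.M₂ (RkOfRecord (F.P p.K).L θ.ν.r (gOfRecord₁₃ F N θ.toStage13Params p j)) j) a 0) (s.Ω j),
        ∃ U₀, IsMinimizer (avOfRecord F N p.K) {U | PlaqSmall (θ.ν.εreg * (F.P p.K).eta j ^ 2) U}
          (Bj θ.ν.M₁ (cubeEnl (F.P p.K) (cubeSide (F.P p.K).L θ.ν.M₂ (RkOfRecord (F.P p.K).L θ.ν.r (gOfRecord₁₃ F N θ.toStage13Params p j)) j) a 4) j)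
          (avgFamily (avOfRecord F N p.K) (qsstarGIter0 j V)) U₀)
    (hcov : ∀ j, 1 ≤ j → j ≤ p.K → ∀ s : SeqOfRecord F θ.ν θ.τ9.M (gOfRecord₁₃ F N θ.toStage13Params p) p.K j,
      s.Ω j ⊆ ⋃ a ∈ cubesIn (fun a : ↥(cubeIndices (F.P p.K) (cubeSide (F.P p.K).L θ.ν.M₂ (RkOfRecord (F.P p.K).L θ.ν.r (gOfRecord₁₃ F N θ.toStage13Params p j)) j)) =>
          cubeEnl (F.P p.K) (cubeSide (F.P p.K).L θ.ν.M₂ (RkOfRecord (F.P p.K).L θ.ν.r (gOfRecord₁₃ F N θ.toStage13Params p j)) j) a 0) (s.Ω j),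
        cubeEnl (F.P p.K) (cubeSide (F.P p.K).L θ.ν.M₂ (RkOfRecord (F.P p.K).L θ.ν.r (gOfRecord₁₃ F N θ.toStage13Params p j)) j) a 0)
    (σ : Sect3Supplier θ p) (hσB : SupplierBorel θ p σ) :
    NoExpansionObligation θ p σ := fun k hk hform s hΩ =>
  clause_succ_sameWitness_of_hasSect2FormAtZS_of_borelB_of_zhPin_of_solvable_all θ p hζ h hθ hθ.toStage12.pos hM₁ hle hk ((Nat.succ_le_of_lt hM₁).trans hle)
    (fun j hj => hw j (hj.trans hk.le)) (hPC.of_le hk.le) (fun j hj => hw j (hj.trans (Nat.succ_le_of_lt hk))) (hPC.of_le hk) hcR (fun j h1 hj => h3 j h1 (hj.trans hk)) (fun j h1 hj => hR j h1 (hj.trans hk)) (fun j h1 hj => hε j h1 (hj.trans hk))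
    (fun j h1 hj => hε3 j h1 (hj.trans hk)) (fun j h1 hj => hε2 j h1 (hj.trans hk)) (fun j h1 hj => hsolv j h1 (hj.trans hk)) (fun j h1 hj => hcov j h1 (hj.trans hk))
    (chainWitness θ p σ k).1 (chainWitness θ p σ k).2 ((chainFormAt_iff σ k).1 hform)
    (fun s₀ S' j X h1 hj => borelB_chainWitness_pos_of_supplierBorel σ hσB k s₀ S' j X h1 hj) s hΩ
    (prefix_agree_of_gaussCert θ p hζ hq s hΩ) (ζ0_pin_of_gaussCert θ p hζ hk s hΩ) (quad_empty_pairCfgAt_of_gaussCert θ p hq s)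
    (quad_local_of_gaussCert θ p hq s) (fun j Y => measurable_ζ0_of_gaussCert θ p hζ h.toCore s j Y) (fun j Λ' => measurable_quad_of_gaussCert θ p hq s j Λ')
    (afibre_rows_adm_of_coercive θ p s fun j => coercive_of_gaussCert θ p hq s j)

/-- **★★★ N11's ONE-TOKEN RESIDUAL `SupplyChainAt θ p` AT A GAUSSIAN CERTIFICATE** (dag-n11-e's `∃ σ, SupplierObligations ∧ NoExpansionObligation`, the input of their node
files `…SupplyChainNode` ∕ `…NodeAtNumerics`) from a supplier with `SupplierObligations` + `SupplierBorel`, K0's rows and the run's structure — NO reading-line primitive.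
[cite: Balaban1988Convergent, Thm 1 p.262, Theorem p.245, §3 p.279, (3.24)–(3.25) p.270] -/
theorem supplyChainAt_of_gaussCert_of_supplierBorel_of_solvable
    (hζ : ∀ (p' : B12.RunParams) (n : ℕ) (Ω Λ : ℕ → Set (Site (F.P p'.K) 0)), (θ.Zh p' n Ω Λ).ζ0 = (ZhPinOfRecord₁₃ θ.toStage13Params p' Ω Λ).ζ0)
    (hq : ∀ (p' : B12.RunParams) (n : ℕ) (Ω Λ : ℕ → Set (Site (F.P p'.K) 0)) (j : ℕ) (Λ' : Set (Site (F.P p'.K) 0)) (ω : MultiCfg (F.P p'.K) (SU N) (FluctV N)),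
      (θ.Zh p' n Ω Λ).quad j Λ' ω = ∑ b ∈ (Set.toFinite (bondsIn j (Λ'ᶜ ∩ Ω (j + 1)))).toFinset, ‖(ω j).2 b‖ ^ 2)
    (h : θ.Provisos₁₃SepCoPH F N) (hθ : θ.Admissible F N) (hM₁ : 0 < θ.ν.M₁) (hle : θ.ν.M₁ ≤ θ.τ9.M) (hcR : 2 ≤ θ.s2.cR)
    (hw : Step.InInterval θ.γ p.K (gOfRecord₁₃ F N θ.toStage13Params p)) (hPC : PartCompat₁₃ F N θ.toStage13Params p p.K)
    (h3 : ∀ j, 1 ≤ j → j ≤ p.K →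
      3 * side (F.P p.K).L θ.ν.M₁ j ≤ cubeSide (F.P p.K).L θ.ν.M₂ (RkOfRecord (F.P p.K).L θ.ν.r (gOfRecord₁₃ F N θ.toStage13Params p j)) j)
    (hR : ∀ j, 1 ≤ j → j ≤ p.K → (F.P p.K).L ^ j + (((F.P p.K).d + 4) * (F.P p.K).L + 2) * (∑ l ∈ Finset.range j, (F.P p.K).L ^ l) + 2 ≤
      cubeSide (F.P p.K).L θ.ν.M₂ (RkOfRecord (F.P p.K).L θ.ν.r (gOfRecord₁₃ F N θ.toStage13Params p j)) j)
    (hε : ∀ j, 1 ≤ j → j ≤ p.K → 0 < epsOfRecord θ.ν (gOfRecord₁₃ F N θ.toStage13Params p) j)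
    (hε3 : ∀ j, 1 ≤ j → j ≤ p.K → (143 * (((((F.P p.K).d + 4 : ℕ) : ℝ)) ^ 2 / 4) ^ 2) * epsOfRecord θ.ν (gOfRecord₁₃ F N θ.toStage13Params p) j ≤ 1 / 3)
    (hε2 : ∀ j, 1 ≤ j → j ≤ p.K →
      2 * epsOfRecord θ.ν (gOfRecord₁₃ F N θ.toStage13Params p) j ≤ 2 * ExpMeanLog.deltaSU (Fin N) / ((((F.P p.K).d + 4) * (F.P p.K).L : ℕ) : ℝ) ^ 2)
    (hsolv : ∀ j, 1 ≤ j → j ≤ p.K → ∀ (s : SeqOfRecord F θ.ν θ.τ9.M (gOfRecord₁₃ F N θ.toStage13Params p) p.K j) (V : GaugeField (F.P p.K) j (SU N)),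
      chiSeqOfRecord F N θ.ν θ.τ9.M (gOfRecord₁₃ F N θ.toStage13Params p) p.K j s V ≠ 0 →
      ∀ a ∈ cubesIn (fun a : ↥(cubeIndices (F.P p.K) (cubeSide (F.P p.K).L θ.ν.M₂ (RkOfRecord (F.P p.K).L θ.ν.r (gOfRecord₁₃ F N θ.toStage13Params p j)) j)) =>
          cubeEnl (F.P p.K) (cubeSide (F.P p.K).L θ.ν.M₂ (RkOfRecord (F.P p.K).L θ.ν.r (gOfRecord₁₃ F N θ.toStage13Params p j)) j) a 0) (s.Ω j),
        ∃ U₀, IsMinimizer (avOfRecord F N p.K) {U | PlaqSmall (θ.ν.εreg * (F.P p.K).eta j ^ 2) U}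
          (Bj θ.ν.M₁ (cubeEnl (F.P p.K) (cubeSide (F.P p.K).L θ.ν.M₂ (RkOfRecord (F.P p.K).L θ.ν.r (gOfRecord₁₃ F N θ.toStage13Params p j)) j) a 4) j)
          (avgFamily (avOfRecord F N p.K) (qsstarGIter0 j V)) U₀)
    (hcov : ∀ j, 1 ≤ j → j ≤ p.K → ∀ s : SeqOfRecord F θ.ν θ.τ9.M (gOfRecord₁₃ F N θ.toStage13Params p) p.K j,
      s.Ω j ⊆ ⋃ a ∈ cubesIn (fun a : ↥(cubeIndices (F.P p.K) (cubeSide (F.P p.K).L θ.ν.M₂ (RkOfRecord (F.P p.K).L θ.ν.r (gOfRecord₁₃ F N θ.toStage13Params p j)) j)) =>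
          cubeEnl (F.P p.K) (cubeSide (F.P p.K).L θ.ν.M₂ (RkOfRecord (F.P p.K).L θ.ν.r (gOfRecord₁₃ F N θ.toStage13Params p j)) j) a 0) (s.Ω j),
        cubeEnl (F.P p.K) (cubeSide (F.P p.K).L θ.ν.M₂ (RkOfRecord (F.P p.K).L θ.ν.r (gOfRecord₁₃ F N θ.toStage13Params p j)) j) a 0)
    (σ : Sect3Supplier θ p) (hσ : SupplierObligations θ p σ) (hσB : SupplierBorel θ p σ) : SupplyChainAt θ p :=
  ⟨σ, hσ, noExpansionObligation_of_gaussCert_of_supplierBorel_of_solvable θ p hζ hq h hθ hM₁ hle hcR hw hPC h3 hR hε hε3 hε2 hsolv hcov σ hσB⟩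

/-- **★★★★ THEOREM 1 OF [III] ALONG THE WITNESS CHAIN AT ANY `θ` OF THE GAUSSIAN CERTIFICATE CLASS — `∀ k ≤ K, SLaw₁₃CoPH θ p k` — FROM `SupplierObligations`, `SupplierBorel`,
K0's ROWS AND THE RUN's STRUCTURE ONLY** (g0's W1-X1 (iv) face RE-KEYED): dag-n11-e's `sLaw₁₃CoPH_all_of_obligations` with its `NoExpansionObligation` DISCHARGED by the
previous theorem.  On the live-selector line (selector clause, admissibility, `0 ≤ κ, E₀, B₀`; `1 ≤ M` from `0 < M₁ ≤ M`).  No reading-line primitive, no operand row, no term bound, no (K0b)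
row, no residual row. [cite: Balaban1988Convergent, Thm 1 p.262, Theorem p.245, §3 p.279, (3.24)–(3.25) p.270; Balaban1989LargeFieldI, (0.2)–(0.4) p.176, p.177 (i)–(ii)] -/
theorem sLaw₁₃CoPH_all_of_obligations_of_gaussCert_of_supplierBorel_of_solvable
    (hζ : ∀ (p' : B12.RunParams) (n : ℕ) (Ω Λ : ℕ → Set (Site (F.P p'.K) 0)), (θ.Zh p' n Ω Λ).ζ0 = (ZhPinOfRecord₁₃ θ.toStage13Params p' Ω Λ).ζ0)
    (hq : ∀ (p' : B12.RunParams) (n : ℕ) (Ω Λ : ℕ → Set (Site (F.P p'.K) 0)) (j : ℕ) (Λ' : Set (Site (F.P p'.K) 0)) (ω : MultiCfg (F.P p'.K) (SU N) (FluctV N)),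
      (θ.Zh p' n Ω Λ).quad j Λ' ω = ∑ b ∈ (Set.toFinite (bondsIn j (Λ'ᶜ ∩ Ω (j + 1)))).toFinset, ‖(ω j).2 b‖ ^ 2)
    (h : θ.Provisos₁₃SepCoPH F N)
    (hsel : θ.ppSel = ppSelLiveOfRecord F N θ.ν θ.τ9 (EOfRecord₁₃ F N θ.toStage13Params) (wOfRecord₉ F N θ.toStage9Params))
    (hθ : θ.Admissible F N) (hκ : 0 ≤ θ.s2.lf.κ) (hE₀ : 0 ≤ θ.s2.lf.E₀) (hB₀ : 0 ≤ θ.s2.lf.B₀)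
    (hM₁ : 0 < θ.ν.M₁) (hle : θ.ν.M₁ ≤ θ.τ9.M) (hcR : 2 ≤ θ.s2.cR)
    (hw : Step.InInterval θ.γ p.K (gOfRecord₁₃ F N θ.toStage13Params p)) (hPC : PartCompat₁₃ F N θ.toStage13Params p p.K)
    (h3 : ∀ j, 1 ≤ j → j ≤ p.K →
      3 * side (F.P p.K).L θ.ν.M₁ j ≤ cubeSide (F.P p.K).L θ.ν.M₂ (RkOfRecord (F.P p.K).L θ.ν.r (gOfRecord₁₃ F N θ.toStage13Params p j)) j)
    (hR : ∀ j, 1 ≤ j → j ≤ p.K → (F.P p.K).L ^ j + (((F.P p.K).d + 4) * (F.P p.K).L + 2) * (∑ l ∈ Finset.range j, (F.P p.K).L ^ l) + 2 ≤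
      cubeSide (F.P p.K).L θ.ν.M₂ (RkOfRecord (F.P p.K).L θ.ν.r (gOfRecord₁₃ F N θ.toStage13Params p j)) j)
    (hε : ∀ j, 1 ≤ j → j ≤ p.K → 0 < epsOfRecord θ.ν (gOfRecord₁₃ F N θ.toStage13Params p) j)
    (hε3 : ∀ j, 1 ≤ j → j ≤ p.K → (143 * (((((F.P p.K).d + 4 : ℕ) : ℝ)) ^ 2 / 4) ^ 2) * epsOfRecord θ.ν (gOfRecord₁₃ F N θ.toStage13Params p) j ≤ 1 / 3)
    (hε2 : ∀ j, 1 ≤ j → j ≤ p.K →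
      2 * epsOfRecord θ.ν (gOfRecord₁₃ F N θ.toStage13Params p) j ≤ 2 * ExpMeanLog.deltaSU (Fin N) / ((((F.P p.K).d + 4) * (F.P p.K).L : ℕ) : ℝ) ^ 2)
    (hsolv : ∀ j, 1 ≤ j → j ≤ p.K → ∀ (s : SeqOfRecord F θ.ν θ.τ9.M (gOfRecord₁₃ F N θ.toStage13Params p) p.K j) (V : GaugeField (F.P p.K) j (SU N)),
      chiSeqOfRecord F N θ.ν θ.τ9.M (gOfRecord₁₃ F N θ.toStage13Params p) p.K j s V ≠ 0 →
      ∀ a ∈ cubesIn (fun a : ↥(cubeIndices (F.P p.K) (cubeSide (F.P p.K).L θ.ν.M₂ (RkOfRecord (F.P p.K).L θ.ν.r (gOfRecord₁₃ F N θ.toStage13Params p j)) j)) =>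
          cubeEnl (F.P p.K) (cubeSide (F.P p.K).L θ.ν.M₂ (RkOfRecord (F.P p.K).L θ.ν.r (gOfRecord₁₃ F N θ.toStage13Params p j)) j) a 0) (s.Ω j),
        ∃ U₀, IsMinimizer (avOfRecord F N p.K) {U | PlaqSmall (θ.ν.εreg * (F.P p.K).eta j ^ 2) U}
          (Bj θ.ν.M₁ (cubeEnl (F.P p.K) (cubeSide (F.P p.K).L θ.ν.M₂ (RkOfRecord (F.P p.K).L θ.ν.r (gOfRecord₁₃ F N θ.toStage13Params p j)) j) a 4) j)
          (avgFamily (avOfRecord F N p.K) (qsstarGIter0 j V)) U₀)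
    (hcov : ∀ j, 1 ≤ j → j ≤ p.K → ∀ s : SeqOfRecord F θ.ν θ.τ9.M (gOfRecord₁₃ F N θ.toStage13Params p) p.K j,
      s.Ω j ⊆ ⋃ a ∈ cubesIn (fun a : ↥(cubeIndices (F.P p.K) (cubeSide (F.P p.K).L θ.ν.M₂ (RkOfRecord (F.P p.K).L θ.ν.r (gOfRecord₁₃ F N θ.toStage13Params p j)) j)) =>
          cubeEnl (F.P p.K) (cubeSide (F.P p.K).L θ.ν.M₂ (RkOfRecord (F.P p.K).L θ.ν.r (gOfRecord₁₃ F N θ.toStage13Params p j)) j) a 0) (s.Ω j),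
        cubeEnl (F.P p.K) (cubeSide (F.P p.K).L θ.ν.M₂ (RkOfRecord (F.P p.K).L θ.ν.r (gOfRecord₁₃ F N θ.toStage13Params p j)) j) a 0)
    (σ : Sect3Supplier θ p) (hσ : SupplierObligations θ p σ) (hσB : SupplierBorel θ p σ) :
    ∀ k, k ≤ p.K → SLaw₁₃CoPH F N θ p k :=
  sLaw₁₃CoPH_all_of_obligations h.toCore hsel hθ hκ hE₀ hB₀ ((Nat.succ_le_of_lt hM₁).trans hle) σ hσ
    (noExpansionObligation_of_gaussCert_of_supplierBorel_of_solvable θ p hζ hq h hθ hM₁ hle hcR hw hPC h3 hR hε hε3 hε2 hsolv hcov σ hσB)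

/-- **THE THEOREM OF p. 245 IN LAW FORM — `∀ k < K, SLaw₁₃CoPH θ p k → TLaw₁₃CoPH θ p k` — AT A GAUSSIAN CERTIFICATE from the same rows** (dag-n11-e's
`thmP245Laws_of_obligations`; the `hT` binder of the node dictionaries). [cite: Balaban1988Convergent, Theorem p.245, Thm 1 p.262, remark p.262, §3 p.279] -/
theorem thmP245Laws_of_gaussCert_of_supplierBorel_of_solvable
    (hζ : ∀ (p' : B12.RunParams) (n : ℕ) (Ω Λ : ℕ → Set (Site (F.P p'.K) 0)), (θ.Zh p' n Ω Λ).ζ0 = (ZhPinOfRecord₁₃ θ.toStage13Params p' Ω Λ).ζ0)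
    (hq : ∀ (p' : B12.RunParams) (n : ℕ) (Ω Λ : ℕ → Set (Site (F.P p'.K) 0)) (j : ℕ) (Λ' : Set (Site (F.P p'.K) 0)) (ω : MultiCfg (F.P p'.K) (SU N) (FluctV N)),
      (θ.Zh p' n Ω Λ).quad j Λ' ω = ∑ b ∈ (Set.toFinite (bondsIn j (Λ'ᶜ ∩ Ω (j + 1)))).toFinset, ‖(ω j).2 b‖ ^ 2)
    (h : θ.Provisos₁₃SepCoPH F N)
    (hsel : θ.ppSel = ppSelLiveOfRecord F N θ.ν θ.τ9 (EOfRecord₁₃ F N θ.toStage13Params) (wOfRecord₉ F N θ.toStage9Params))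
    (hθ : θ.Admissible F N) (hκ : 0 ≤ θ.s2.lf.κ) (hE₀ : 0 ≤ θ.s2.lf.E₀) (hB₀ : 0 ≤ θ.s2.lf.B₀)
    (hM₁ : 0 < θ.ν.M₁) (hle : θ.ν.M₁ ≤ θ.τ9.M) (hcR : 2 ≤ θ.s2.cR)
    (hw : Step.InInterval θ.γ p.K (gOfRecord₁₃ F N θ.toStage13Params p)) (hPC : PartCompat₁₃ F N θ.toStage13Params p p.K)
    (h3 : ∀ j, 1 ≤ j → j ≤ p.K →
      3 * side (F.P p.K).L θ.ν.M₁ j ≤ cubeSide (F.P p.K).L θ.ν.M₂ (RkOfRecord (F.P p.K).L θ.ν.r (gOfRecord₁₃ F N θ.toStage13Params p j)) j)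
    (hR : ∀ j, 1 ≤ j → j ≤ p.K → (F.P p.K).L ^ j + (((F.P p.K).d + 4) * (F.P p.K).L + 2) * (∑ l ∈ Finset.range j, (F.P p.K).L ^ l) + 2 ≤
      cubeSide (F.P p.K).L θ.ν.M₂ (RkOfRecord (F.P p.K).L θ.ν.r (gOfRecord₁₃ F N θ.toStage13Params p j)) j)
    (hε : ∀ j, 1 ≤ j → j ≤ p.K → 0 < epsOfRecord θ.ν (gOfRecord₁₃ F N θ.toStage13Params p) j)
    (hε3 : ∀ j, 1 ≤ j → j ≤ p.K → (143 * (((((F.P p.K).d + 4 : ℕ) : ℝ)) ^ 2 / 4) ^ 2) * epsOfRecord θ.ν (gOfRecord₁₃ F N θ.toStage13Params p) j ≤ 1 / 3)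
    (hε2 : ∀ j, 1 ≤ j → j ≤ p.K →
      2 * epsOfRecord θ.ν (gOfRecord₁₃ F N θ.toStage13Params p) j ≤ 2 * ExpMeanLog.deltaSU (Fin N) / ((((F.P p.K).d + 4) * (F.P p.K).L : ℕ) : ℝ) ^ 2)
    (hsolv : ∀ j, 1 ≤ j → j ≤ p.K → ∀ (s : SeqOfRecord F θ.ν θ.τ9.M (gOfRecord₁₃ F N θ.toStage13Params p) p.K j) (V : GaugeField (F.P p.K) j (SU N)),
      chiSeqOfRecord F N θ.ν θ.τ9.M (gOfRecord₁₃ F N θ.toStage13Params p) p.K j s V ≠ 0 →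
      ∀ a ∈ cubesIn (fun a : ↥(cubeIndices (F.P p.K) (cubeSide (F.P p.K).L θ.ν.M₂ (RkOfRecord (F.P p.K).L θ.ν.r (gOfRecord₁₃ F N θ.toStage13Params p j)) j)) =>
          cubeEnl (F.P p.K) (cubeSide (F.P p.K).L θ.ν.M₂ (RkOfRecord (F.P p.K).L θ.ν.r (gOfRecord₁₃ F N θ.toStage13Params p j)) j) a 0) (s.Ω j),
        ∃ U₀, IsMinimizer (avOfRecord F N p.K) {U | PlaqSmall (θ.ν.εreg * (F.P p.K).eta j ^ 2) U}
          (Bj θ.ν.M₁ (cubeEnl (F.P p.K) (cubeSide (F.P p.K).L θ.ν.M₂ (RkOfRecord (F.P p.K).L θ.ν.r (gOfRecord₁₃ F N θ.toStage13Params p j)) j) a 4) j)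
          (avgFamily (avOfRecord F N p.K) (qsstarGIter0 j V)) U₀)
    (hcov : ∀ j, 1 ≤ j → j ≤ p.K → ∀ s : SeqOfRecord F θ.ν θ.τ9.M (gOfRecord₁₃ F N θ.toStage13Params p) p.K j,
      s.Ω j ⊆ ⋃ a ∈ cubesIn (fun a : ↥(cubeIndices (F.P p.K) (cubeSide (F.P p.K).L θ.ν.M₂ (RkOfRecord (F.P p.K).L θ.ν.r (gOfRecord₁₃ F N θ.toStage13Params p j)) j)) =>
          cubeEnl (F.P p.K) (cubeSide (F.P p.K).L θ.ν.M₂ (RkOfRecord (F.P p.K).L θ.ν.r (gOfRecord₁₃ F N θ.toStage13Params p j)) j) a 0) (s.Ω j),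
        cubeEnl (F.P p.K) (cubeSide (F.P p.K).L θ.ν.M₂ (RkOfRecord (F.P p.K).L θ.ν.r (gOfRecord₁₃ F N θ.toStage13Params p j)) j) a 0)
    (σ : Sect3Supplier θ p) (hσ : SupplierObligations θ p σ) (hσB : SupplierBorel θ p σ) :
    ∀ k, k < p.K → SLaw₁₃CoPH F N θ p k → TLaw₁₃CoPH F N θ p k :=
  thmP245Laws_of_obligations h.toCore hsel hθ hκ hE₀ hB₀ ((Nat.succ_le_of_lt hM₁).trans hle) σ hσ
    (noExpansionObligation_of_gaussCert_of_supplierBorel_of_solvable θ p hζ hq h hθ hM₁ hle hcR hw hPC h3 hR hε hε3 hε2 hsolv hcov σ hσB)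

end Obligation

end Summit.QuantumFields.YangMills.Theorems.BalabanUVNodesN11Sect3SupplyChainBorelBObligationsOfSolvable

end
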